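import Summits.ValiantsHypothesis.ValiantsHypothesis.Theorems.LacunarySymmetroidMatrixDescartesCensusChamberTableB
import Summits.ValiantsHypothesis.ValiantsHypothesis.Theorems.LacunarySymmetroidMatrixDescartesCensusDefs

/-!
# `MatrixDescartes` census — `stub_easyChambers` of the crux line `census` (DoorA26): GLUE from 163 blocks of 16 chamber ids

HONEST FRAMING.  Object-search cell `pub-symmetroid`; crux `DoorA26 = PosRootLawAt 2 6 19` (stmt-ValiantsHypothesis-19979; OPEN, typed, never asserted).
Pure bookkeeping for the stub `stub_easyChambers` («every listed non-hard chamber carries the door-A row») of `Cruxes/DoorA26/Lines/census.lean`: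
the table `Census.chamber` is organised in 163 blocks of 16 ids (`…CensusChamberTableA/B`), the per-chamber rows `doorA26_on_chamber<n>` land one by one
(door-p2, engines, …), a BLOCK file `…CensusEasyBlock<k>` assembles ids `16k … 16k+15` as soon as all its non-hard rows are in the tree (generator
`gen_dispatch.py`, val-sym-door-p5 g6, HOME/val-sym-door-p5/g6/work/dispatch/), and `easyChambers_of_blocks` below turns the 163 block statements into
VERBATIM the body of `Stmt.stub_easyChambers` (arithmetic only: `k = n / 16`).  Nothing here proves any row; `DoorA26` OPEN; registers unchanged; nothing
on `MatrixDescartes` (stmt-ValiantsHypothesis-18050) or `VP ≠ VNP`.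

[folklore] Elementary.
-/

-- `Summit.ValiantsHypothesis.ValiantsHypothesis.…` repeats a component by the D-0017 layout
-- (single-conjunct summit), which the `dupNamespace` linter flags; the name is mandated.
set_option linter.dupNamespace false

namespace Summit.ValiantsHypothesis.ValiantsHypothesis.Theorems.LacunarySymmetroidMatrixDescartes.Census

/-- **Glue for `stub_easyChambers`**: if every block `k < 163` of sixteen consecutive chamber ids carries the door-A row on its non-hard ids, then every
listed non-hard chamber `n < 2608` carries it (`k := n / 16`).  The conclusion is VERBATIM the body of `Stmt.stub_easyChambers`. [folklore] -/
theorem easyChambers_of_blocks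
    (h : ∀ k < 163, ∀ n, 16 * k ≤ n → n < 16 * k + 16 → n ∉ [1, 954, 1706, 1709] →
      ∀ d : Fin 6 → ℕ, StrictMono ((fun p : Fin 6 × Fin 6 => d p.1 + d p.2) ∘ chamber n) → PosRootLawOn 2 6 19 d) :
    ∀ n < 2608, n ∉ [1, 954, 1706, 1709] →
      ∀ d : Fin 6 → ℕ, StrictMono ((fun p : Fin 6 × Fin 6 => d p.1 + d p.2) ∘ chamber n) → PosRootLawOn 2 6 19 d :=
  fun n hn hh d hd => h (n / 16) (by omega) n (by omega) (by omega) hh d hd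

end Summit.ValiantsHypothesis.ValiantsHypothesis.Theorems.LacunarySymmetroidMatrixDescartes.Census
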